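import Literature.NumberTheory.Automorphic.UnitaryThreePHTowerIndex                 -- (F3c-β-ii) FILE C: (H2)
import Literature.NumberTheory.LocalFields.UnramifiedQuadraticNormQuadraticCount     -- ★ A-p03: `natCard_antifixed_quotient_pow`
import Literature.NumberTheory.LocalFields.UnramifiedQuadraticOrderUnitIndex         -- ★ F0P2-p06: `natCard_units_quotient_pow`
import HarnessLib

/-!
# The tower for Flicker's Prop. 8 (ii), FILE D — THE PACKAGE: `[P_H : N₀(ϖ^m)] = #(𝒪⧸𝓂^m)ˣ · #{anti-fixed}`, **`[P_H : P_H ∩ H^K_m] = (q² − 1)·q^{4m−2}`**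
# (`= 1` at `m = 0`), finiteness of `P_H ⧸ (P_H ∩ H^K_m)`, and the fibres of `ρ_m` on it have `q^m` elements
(Flicker, *Elementary proof of the fundamental lemma for a unitary group* (1998), Prop. 8 pp. 84–85: `[P_H : P_H ∩ H^K_m] = (1 − q⁻²) q^{4m}`)

Topic `NumberTheory/Automorphic`; namespace `Literature.NumberTheory.Automorphic.UnitaryGroup`.  THEOREMS ONLY (no `def`, no instance, no notation, no named fact,
no `sorry`).  Cell `pub/hodgecm-mathlib`, F0∕P3a road «N7-ns COUNT FROM FLICKER» (MAP v3, architect A-p06 (g26)), brick **(F3c-β-ii) PROP. 8 (ii)**, fourth file of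
the tower (B-p04 (g33)) over ★ FILE A p841106 ∕ FILE B p841210 ∕ FILE C p841322 and the class counts ★ `natCard_antifixed_quotient_pow` (A-p03 p841180) ∕ ★
`natCard_units_quotient_pow` (F0P2-p06).  Its heads are, VERBATIM, the hypotheses `hidx0`, `hidx`, `hSN` (= ★ `inf_flickerHK_le_flickerPH0`), `hfib` and the instance
`[Finite (P_H ⧸ S)]` of ★ A-p03's Prop. 10 count `natCard_cosets_eq_iTen` (tokens: `[IsDiscreteValuationRing 𝒪[K]] [Finite (ResidueField 𝒪[K])]`,
`hq : Nat.card (ResidueField 𝒪[K]) = q ^ 2`, `ha₀ : IsUnit (σO a₀ − a₀)`, `σO := (σ.comp 𝒪[K].subtype).codRestrict 𝒪[K] hσO`).  HC_CM is proved only modulo the printed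
citations until rung 0 closes; structure theory for ONE clause of #103-ns, pays nothing by itself.

* `v_eq_one_of_isUnit_mk` — a unit class modulo `𝓂^m`, `m ≥ 1`, has only unit representatives.
* **`index_flickerPH0_subgroupOf_flickerPH`** — `[P_H : N₀(ϖ^m)] = #(𝒪⧸𝓂^m)ˣ · #{anti-fixed}`: (H1)+(H3) of FILE B as the bijection `P_H ⧸ N₀ ≃ units × anti-fixed`
  through `ρ_m` (`Quotient.lift`); any `m` (at `m = 0` the unit class is represented by `1`).
* **`index_flickerHK_subgroupOf_flickerPH`** — `[P_H : P_H ∩ H^K_m] = #{anti-fixed} · (#units · #{anti-fixed})` (tower, `relIndex_mul_relIndex`, no finiteness needed).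
* `natCard_antifixed_eq` (`= q^m`, ★ A-p03 at `R := 𝒪[K]`, `σ := σO`), `natCard_units_quotient_eq` (`= (q²)^{m−1}(q²−1)` resp. `1` at `m = 0`, ★ F0P2-p06).
* **`index_flickerHK_subgroupOf_flickerPH_eq (hm : 1 ≤ m) : … = (q ^ 2 − 1) * q ^ (4 * m − 2)`** (= `hidx`), **`index_flickerHK_subgroupOf_flickerPH_eq_one`** (`m = 0`, = `hidx0`),
  **`finite_quotient_flickerHK : Finite (↥P_H ⧸ S)`**, **`natCard_fibre_flickerPHRho_eq`** (= `hfib`: every fibre of `w ↦ ρ_m(out w)` on `P_H ⧸ S` has `q^m` elements —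
  the fibre over `ρ_m(p₀)` is `N₀ ⧸ S` translated by `p₀`, counted by FILE C's (H2)).

## References
* [Flicker1998UnitaryFL] Y. Z. Flicker, *Elementary proof of the fundamental lemma for a unitary group*, Canad. J. Math. 50 (1998), Prop. 8 pp. 84–85.
-/

open scoped MatrixGroups WithZero Valued
open Matrix IsLocalRing

namespace Literature.NumberTheory.Automorphic

namespace UnitaryGroup

open Literature.NumberTheory.Automorphic.HermitianLattice (unitaryInt mem_unitaryInt_iff LocalConjDatum)

section Package

variable {K : Type*} [Field K] [Valued K ℤᵐ⁰] {ϖ : K} (σ : K →+* K) {J : Matrix (Fin 3) (Fin 3) K} (hJ : J = (StdForm.antidiagonal 3).over K)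

/-- A unit CLASS modulo `𝓂^m`, `m ≥ 1`, has unit representatives only: `IsUnit ⟦a⟧ → |a| = 1`. [cite: Flicker1998UnitaryFL, Prop. 8 p. 85] -/
theorem v_eq_one_of_isUnit_mk (hϖ : Valued.v ϖ = WithZero.exp (-1 : ℤ)) {m : ℕ} (hm : 1 ≤ m) {a : 𝒪[K]}
    (ha : IsUnit (Ideal.Quotient.mk (𝓂[K] ^ m) a)) : Valued.v (a : K) = 1 := by
  obtain ⟨u, hu⟩ := ha
  obtain ⟨b, hb⟩ := Ideal.Quotient.mk_surjective (↑u⁻¹ : 𝒪[K] ⧸ 𝓂[K] ^ m)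
  have hab : Ideal.Quotient.mk (𝓂[K] ^ m) (a * b) = 1 := by rw [map_mul, ← hu, hb, Units.mul_inv]
  rw [← (Ideal.Quotient.mk (𝓂[K] ^ m)).map_one, Ideal.Quotient.eq, mem_maximalIdeal_pow_iff_v_le hϖ] at hab
  have hlt : Valued.v ((a : K) * b - 1) < 1 := by
    refine lt_of_le_of_lt hab ?_
    rw [map_pow, hϖ, ← WithZero.exp_zero, ← WithZero.exp_nsmul, WithZero.exp_lt_exp]; simp; omega
  have h1 : Valued.v ((a : K) * b) = 1 := by
    have := Valuation.map_one_add_of_lt (Valued.v) hlt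
    rwa [add_sub_cancel] at this
  rw [map_mul] at h1
  refine le_antisymm a.2 (le_of_not_gt fun hlt' => ?_)
  have : Valued.v (a : K) * Valued.v (b : K) < 1 := (mul_le_mul' le_rfl b.2).trans_lt (by rw [mul_one]; exact hlt')
  rw [h1] at this
  exact lt_irrefl _ this

include hJ in
/-- **(H1) + (H3) packaged: `P_H ⧸ N₀(ϖ^m) ≃ (𝒪⧸𝓂^m)ˣ × {anti-fixed classes}`** through `ρ_m`, hence
`[P_H : N₀(ϖ^m)] = #(𝒪⧸𝓂^m)ˣ · #{β : σ̄β = −β}` (`= (q²−1)q^{2m−2} · q^m` for `m ≥ 1`). [cite: Flicker1998UnitaryFL, Prop. 8 pp. 84–85] -/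
theorem index_flickerPH0_subgroupOf_flickerPH (hd : LocalConjDatum σ ϖ) (hσO : ∀ z : 𝒪[K], (σ.comp 𝒪[K].subtype) z ∈ 𝒪[K]) (m : ℕ)
    {c : ↥(unitaryGroupOfForm σ J)} (hc : ((c : GL (Fin 3) K) : Matrix (Fin 3) (Fin 3) K) = !![1, 0, 0; 0, -1, 0; 0, 0, 1]) :
    ((flickerPH0 σ J c (ϖ ^ m)).subgroupOf (flickerPH σ J c)).index =
      Nat.card (𝒪[K] ⧸ 𝓂[K] ^ m)ˣ *
        Nat.card {β : 𝒪[K] ⧸ 𝓂[K] ^ m //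
          Ideal.quotientMap (𝓂[K] ^ m) ((σ.comp 𝒪[K].subtype).codRestrict 𝒪[K] hσO)
            (maximalIdeal_pow_le_comap_codRestrict σ hd.vϖ hd.vσ hσO m) β = -β} := by
  set σq := Ideal.quotientMap (𝓂[K] ^ m) ((σ.comp 𝒪[K].subtype).codRestrict 𝒪[K] hσO)
    (maximalIdeal_pow_le_comap_codRestrict σ hd.vϖ hd.vσ hσO m) with hσq
  set P := flickerPH σ J c with hPdef
  set N := (flickerPH0 σ J c (ϖ ^ m)).subgroupOf P with hNdef
  let X := {q : (𝒪[K] ⧸ 𝓂[K] ^ m) × (𝒪[K] ⧸ 𝓂[K] ^ m) // IsUnit q.1 ∧ σq q.2 = -q.2}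
  let ρX : ↥P → X := fun p => ⟨flickerPHRho σ m (p : ↥(unitaryGroupOfForm σ J)),
    isUnit_flickerPHRho_fst σ hJ hd hc m p.2, quotientMap_flickerPHRho_snd σ hJ hd hσO hc m p.2⟩
  have hwd : ∀ a b : ↥P, QuotientGroup.leftRel N a b → ρX a = ρX b := by
    intro a b hab
    rw [QuotientGroup.leftRel_apply, hNdef, Subgroup.mem_subgroupOf, Subgroup.coe_mul, Subgroup.coe_inv] at hab
    apply Subtype.ext
    exact (flickerPHRho_eq_iff σ hJ hd hc m a.2 b.2).2 hab
  let ρQ : ↥P ⧸ N → X := Quotient.lift ρX hwd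
  have hbij : Function.Bijective ρQ := by
    constructor
    · intro q₁ q₂ h
      induction q₁ using QuotientGroup.induction_on with | H a => ?_
      induction q₂ using QuotientGroup.induction_on with | H b => ?_
      apply Quotient.sound
      change QuotientGroup.leftRel N a b
      rw [QuotientGroup.leftRel_apply, hNdef, Subgroup.mem_subgroupOf, Subgroup.coe_mul, Subgroup.coe_inv]
      exact (flickerPHRho_eq_iff σ hJ hd hc m a.2 b.2).1 (congrArg Subtype.val h)
    · rintro ⟨⟨α, β⟩, hα, hβ⟩
      obtain ⟨b, rfl⟩ := Ideal.Quotient.mk_surjective β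
      -- a representative of valuation one for the unit class `α`
      obtain ⟨a, ha, rfl⟩ : ∃ a : 𝒪[K], Valued.v (a : K) = 1 ∧ Ideal.Quotient.mk (𝓂[K] ^ m) a = α := by
        rcases Nat.eq_zero_or_pos m with hm | hm
        · refine ⟨1, by rw [OneMemClass.coe_one, map_one], ?_⟩
          obtain ⟨a, rfl⟩ := Ideal.Quotient.mk_surjective α
          rw [Ideal.Quotient.eq, hm, pow_zero, Ideal.one_eq_top]; exact Submodule.mem_top
        · obtain ⟨a, rfl⟩ := Ideal.Quotient.mk_surjective α
          exact ⟨a, v_eq_one_of_isUnit_mk hd.vϖ hm hα, rfl⟩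
      obtain ⟨p, hp, hρ⟩ := exists_mem_flickerPH_flickerPHRho_eq σ hJ hd hσO hc m a b ha hβ
      refine ⟨QuotientGroup.mk ⟨p, hp⟩, ?_⟩
      apply Subtype.ext
      exact hρ
  rw [Subgroup.index, Nat.card_congr (Equiv.ofBijective ρQ hbij)]
  -- `#X = #units · #anti-fixed`
  rw [← Nat.card_prod]
  refine Nat.card_congr
    { toFun := fun q => (q.2.1.unit, ⟨q.1.2, q.2.2⟩)
      invFun := fun y => ⟨(↑y.1, y.2.1), Units.isUnit _, y.2.2⟩
      left_inv := fun q => by ext <;> simp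
      right_inv := fun y => by ext <;> simp }

include hJ in
/-- **PROP. 8 (ii) as a product of class counts**: `[P_H : P_H ∩ H^K_m] = #{anti-fixed} · (#(𝒪⧸𝓂^m)ˣ · #{anti-fixed})` — the tower
`P_H ⊇ N₀(ϖ^m) ⊇ P_H ∩ H^K_m` with (H2) below and (H1)+(H3) above (`Subgroup.relIndex_mul_relIndex`). [cite: Flicker1998UnitaryFL, Prop. 8 pp. 84–85] -/
theorem index_flickerHK_subgroupOf_flickerPH (hd : LocalConjDatum σ ϖ) {y : K} (hy : y * σ y = -2)
    (hσO : ∀ z : 𝒪[K], (σ.comp 𝒪[K].subtype) z ∈ 𝒪[K]) (m : ℕ) {um c : ↥(unitaryGroupOfForm σ J)}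
    (hum : ((um : GL (Fin 3) K) : Matrix (Fin 3) (Fin 3) K) = !![ϖ ^ m, y, (ϖ ^ m)⁻¹; 0, 1, -σ y * (ϖ ^ m)⁻¹; 0, 0, (ϖ ^ m)⁻¹])
    (hc : ((c : GL (Fin 3) K) : Matrix (Fin 3) (Fin 3) K) = !![1, 0, 0; 0, -1, 0; 0, 0, 1]) :
    ((flickerHK σ J c um).subgroupOf (flickerPH σ J c)).index =
      Nat.card {β : 𝒪[K] ⧸ 𝓂[K] ^ m //
          Ideal.quotientMap (𝓂[K] ^ m) ((σ.comp 𝒪[K].subtype).codRestrict 𝒪[K] hσO)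
            (maximalIdeal_pow_le_comap_codRestrict σ hd.vϖ hd.vσ hσO m) β = -β} *
        (Nat.card (𝒪[K] ⧸ 𝓂[K] ^ m)ˣ *
          Nat.card {β : 𝒪[K] ⧸ 𝓂[K] ^ m //
            Ideal.quotientMap (𝓂[K] ^ m) ((σ.comp 𝒪[K].subtype).codRestrict 𝒪[K] hσO)
              (maximalIdeal_pow_le_comap_codRestrict σ hd.vϖ hd.vσ hσO m) β = -β}) := by
  have hSN : flickerPH σ J c ⊓ flickerHK σ J c um ≤ flickerPH0 σ J c (ϖ ^ m) := inf_flickerHK_le_flickerPH0 σ hJ hd hy m hum hc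
  have hNP : flickerPH0 σ J c (ϖ ^ m) ≤ flickerPH σ J c := flickerPH0_le c (ϖ ^ m)
  rw [← index_flickerPH0_subgroupOf_flickerPH σ hJ hd hσO m hc]
  rw [← index_inf_flickerHK_subgroupOf_flickerPH0 σ hJ hd hy hσO m hum hc]
  change (flickerHK σ J c um).relIndex (flickerPH σ J c) =
    (flickerPH σ J c ⊓ flickerHK σ J c um).relIndex (flickerPH0 σ J c (ϖ ^ m)) * (flickerPH0 σ J c (ϖ ^ m)).relIndex (flickerPH σ J c)
  rw [Subgroup.relIndex_mul_relIndex _ _ _ hSN hNP, Subgroup.inf_relIndex_left]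

variable [IsDiscreteValuationRing 𝒪[K]] [Finite (ResidueField 𝒪[K])]

omit [Finite (ResidueField 𝒪[K])] in
/-- The anti-fixed class count at `R := 𝒪[K]`, `σ := σO` (★ `natCard_antifixed_quotient_pow`, A-p03). [cite: Flicker1998UnitaryFL, Prop. 8 p. 85] -/
theorem natCard_antifixed_eq (hd : LocalConjDatum σ ϖ) (hσO : ∀ z : 𝒪[K], (σ.comp 𝒪[K].subtype) z ∈ 𝒪[K])
    {q : ℕ} (hq : Nat.card (ResidueField 𝒪[K]) = q ^ 2)
    {a₀ : 𝒪[K]} (ha₀ : IsUnit (((σ.comp 𝒪[K].subtype).codRestrict 𝒪[K] hσO) a₀ - a₀)) (m : ℕ) :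
    Nat.card {β : 𝒪[K] ⧸ 𝓂[K] ^ m //
        Ideal.quotientMap (𝓂[K] ^ m) ((σ.comp 𝒪[K].subtype).codRestrict 𝒪[K] hσO)
          (maximalIdeal_pow_le_comap_codRestrict σ hd.vϖ hd.vσ hσO m) β = -β} = q ^ m := by
  have hσσ : ∀ z : 𝒪[K], ((σ.comp 𝒪[K].subtype).codRestrict 𝒪[K] hσO) (((σ.comp 𝒪[K].subtype).codRestrict 𝒪[K] hσO) z) = z :=
    fun z => Subtype.ext (hd.σσ (z : K))
  exact Literature.NumberTheory.LocalFields.UnramifiedQuadraticNorm.natCard_antifixed_quotient_pow _ hσσ ha₀ hq m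

/-- The unit class count at `R := 𝒪[K]` (★ `natCard_units_quotient_pow`, F0P2-p06), and the trivial case `m = 0`. [cite: Flicker1998UnitaryFL, Prop. 8 p. 85] -/
theorem natCard_units_quotient_eq {q : ℕ} (hq : Nat.card (ResidueField 𝒪[K]) = q ^ 2) (m : ℕ) :
    Nat.card (𝒪[K] ⧸ 𝓂[K] ^ m)ˣ = if m = 0 then 1 else (q ^ 2) ^ (m - 1) * (q ^ 2 - 1) := by
  split_ifs with hm
  · subst hm
    haveI : Subsingleton (𝒪[K] ⧸ 𝓂[K] ^ 0) := by
      rw [pow_zero, Ideal.one_eq_top]; exact Ideal.Quotient.subsingleton_iff.2 rfl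
    exact Nat.card_unique
  · exact Literature.NumberTheory.LocalFields.UnramifiedQuadraticNorm.natCard_units_quotient_pow hq (Nat.one_le_iff_ne_zero.2 hm)

include hJ in
/-- **FLICKER'S PROPOSITION 8 (ii): `[P_H : P_H ∩ H^K_m] = (q² − 1)·q^{4m−2}`** for `m ≥ 1` (print: `(1 − q⁻²) q^{4m}`) — the hypothesis `hidx` of ★ A-p03's
Prop. 10 count. [cite: Flicker1998UnitaryFL, Prop. 8 pp. 84–85] -/
theorem index_flickerHK_subgroupOf_flickerPH_eq (hd : LocalConjDatum σ ϖ) {y : K} (hy : y * σ y = -2)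
    (hσO : ∀ z : 𝒪[K], (σ.comp 𝒪[K].subtype) z ∈ 𝒪[K]) {m : ℕ} (hm : 1 ≤ m) {um c : ↥(unitaryGroupOfForm σ J)}
    (hum : ((um : GL (Fin 3) K) : Matrix (Fin 3) (Fin 3) K) = !![ϖ ^ m, y, (ϖ ^ m)⁻¹; 0, 1, -σ y * (ϖ ^ m)⁻¹; 0, 0, (ϖ ^ m)⁻¹])
    (hc : ((c : GL (Fin 3) K) : Matrix (Fin 3) (Fin 3) K) = !![1, 0, 0; 0, -1, 0; 0, 0, 1])
    {q : ℕ} (hq : Nat.card (ResidueField 𝒪[K]) = q ^ 2)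
    {a₀ : 𝒪[K]} (ha₀ : IsUnit (((σ.comp 𝒪[K].subtype).codRestrict 𝒪[K] hσO) a₀ - a₀)) :
    ((flickerHK σ J c um).subgroupOf (flickerPH σ J c)).index = (q ^ 2 - 1) * q ^ (4 * m - 2) := by
  rw [index_flickerHK_subgroupOf_flickerPH σ hJ hd hy hσO m hum hc, natCard_antifixed_eq σ hd hσO hq ha₀ m,
    natCard_units_quotient_eq hq m, if_neg (by omega)]
  obtain ⟨k, rfl⟩ := Nat.exists_eq_add_of_le' hm
  rw [Nat.add_sub_cancel, show 4 * (k + 1) - 2 = k + 1 + 2 * k + (k + 1) by omega]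
  ring

include hJ in
/-- **PROP. 8 (ii) at `m = 0`: `[P_H : P_H ∩ H^K_0] = 1`** (everything is integral) — the hypothesis `hidx0` of ★ A-p03's Prop. 10 count.
[cite: Flicker1998UnitaryFL, Prop. 8 pp. 84–85] -/
theorem index_flickerHK_subgroupOf_flickerPH_eq_one (hd : LocalConjDatum σ ϖ) {y : K} (hy : y * σ y = -2)
    (hσO : ∀ z : 𝒪[K], (σ.comp 𝒪[K].subtype) z ∈ 𝒪[K]) {um c : ↥(unitaryGroupOfForm σ J)}
    (hum : ((um : GL (Fin 3) K) : Matrix (Fin 3) (Fin 3) K) = !![ϖ ^ 0, y, (ϖ ^ 0)⁻¹; 0, 1, -σ y * (ϖ ^ 0)⁻¹; 0, 0, (ϖ ^ 0)⁻¹])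
    (hc : ((c : GL (Fin 3) K) : Matrix (Fin 3) (Fin 3) K) = !![1, 0, 0; 0, -1, 0; 0, 0, 1])
    {q : ℕ} (hq : Nat.card (ResidueField 𝒪[K]) = q ^ 2)
    {a₀ : 𝒪[K]} (ha₀ : IsUnit (((σ.comp 𝒪[K].subtype).codRestrict 𝒪[K] hσO) a₀ - a₀)) :
    ((flickerHK σ J c um).subgroupOf (flickerPH σ J c)).index = 1 := by
  rw [index_flickerHK_subgroupOf_flickerPH σ hJ hd hy hσO 0 hum hc, natCard_antifixed_eq σ hd hσO hq ha₀ 0,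
    natCard_units_quotient_eq hq 0, if_pos rfl, pow_zero, mul_one, mul_one]

include hJ in
/-- `P_H ⧸ (P_H ∩ H^K_m)` is FINITE (its cardinality is `(q²−1)q^{4m−2}` resp. `1`) — the instance binder of ★ A-p03's Prop. 10 count.
[cite: Flicker1998UnitaryFL, Prop. 8 pp. 84–85] -/
theorem finite_quotient_flickerHK (hd : LocalConjDatum σ ϖ) {y : K} (hy : y * σ y = -2)
    (hσO : ∀ z : 𝒪[K], (σ.comp 𝒪[K].subtype) z ∈ 𝒪[K]) (m : ℕ) {um c : ↥(unitaryGroupOfForm σ J)}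
    (hum : ((um : GL (Fin 3) K) : Matrix (Fin 3) (Fin 3) K) = !![ϖ ^ m, y, (ϖ ^ m)⁻¹; 0, 1, -σ y * (ϖ ^ m)⁻¹; 0, 0, (ϖ ^ m)⁻¹])
    (hc : ((c : GL (Fin 3) K) : Matrix (Fin 3) (Fin 3) K) = !![1, 0, 0; 0, -1, 0; 0, 0, 1])
    {q : ℕ} (hq : Nat.card (ResidueField 𝒪[K]) = q ^ 2)
    {a₀ : 𝒪[K]} (ha₀ : IsUnit (((σ.comp 𝒪[K].subtype).codRestrict 𝒪[K] hσO) a₀ - a₀)) :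
    Finite (↥(flickerPH σ J c) ⧸ (flickerHK σ J c um).subgroupOf (flickerPH σ J c)) := by
  have hq2 : 2 ≤ q := by
    have h1 : 1 < Nat.card (ResidueField 𝒪[K]) := Finite.one_lt_card_iff_nontrivial.2 inferInstance
    rw [hq] at h1
    by_contra hlt
    interval_cases q <;> simp at h1
  haveI : ((flickerHK σ J c um).subgroupOf (flickerPH σ J c)).FiniteIndex := by
    refine ⟨?_⟩
    rw [index_flickerHK_subgroupOf_flickerPH σ hJ hd hy hσO m hum hc, natCard_antifixed_eq σ hd hσO hq ha₀ m, natCard_units_quotient_eq hq m]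
    split_ifs with hm
    · positivity
    · have : 1 ≤ q ^ 2 - 1 := Nat.le_sub_of_add_le (by nlinarith)
      positivity
  infer_instance

omit [Finite (ResidueField 𝒪[K])] in
include hJ in
/-- **THE FIBRES OF `ρ_m` ON `P_H ⧸ (P_H ∩ H^K_m)` HAVE `q^m` ELEMENTS**: the cosets `w` with `ρ_m(out w) = ρ_m(p₀)` are exactly those inside `p₀·N₀(ϖ^m)` ((H1)),
in bijection with `N₀ ⧸ (P_H ∩ H^K_m)` ((H2): `#{anti-fixed} = q^m`).  This is the hypothesis `hfib` of ★ A-p03's Prop. 10 count. [cite: Flicker1998UnitaryFL, Prop. 8 pp. 84–85] -/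
theorem natCard_fibre_flickerPHRho_eq (hd : LocalConjDatum σ ϖ) {y : K} (hy : y * σ y = -2)
    (hσO : ∀ z : 𝒪[K], (σ.comp 𝒪[K].subtype) z ∈ 𝒪[K]) (m : ℕ) {um c : ↥(unitaryGroupOfForm σ J)}
    (hum : ((um : GL (Fin 3) K) : Matrix (Fin 3) (Fin 3) K) = !![ϖ ^ m, y, (ϖ ^ m)⁻¹; 0, 1, -σ y * (ϖ ^ m)⁻¹; 0, 0, (ϖ ^ m)⁻¹])
    (hc : ((c : GL (Fin 3) K) : Matrix (Fin 3) (Fin 3) K) = !![1, 0, 0; 0, -1, 0; 0, 0, 1])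
    {q : ℕ} (hq : Nat.card (ResidueField 𝒪[K]) = q ^ 2)
    {a₀ : 𝒪[K]} (ha₀ : IsUnit (((σ.comp 𝒪[K].subtype).codRestrict 𝒪[K] hσO) a₀ - a₀)) :
    ∀ z ∈ Set.range (fun w : ↥(flickerPH σ J c) ⧸ (flickerHK σ J c um).subgroupOf (flickerPH σ J c) =>
        flickerPHRho σ m ((Quotient.out w : ↥(flickerPH σ J c)) : ↥(unitaryGroupOfForm σ J))),
      Nat.card {w : ↥(flickerPH σ J c) ⧸ (flickerHK σ J c um).subgroupOf (flickerPH σ J c) //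
        flickerPHRho σ m ((Quotient.out w : ↥(flickerPH σ J c)) : ↥(unitaryGroupOfForm σ J)) = z} = q ^ m := by
  rintro z ⟨w₀, rfl⟩
  show Nat.card {w : ↥(flickerPH σ J c) ⧸ ((flickerHK σ J c um).subgroupOf (flickerPH σ J c)) // flickerPHRho σ m ((Quotient.out w : ↥(flickerPH σ J c)) : ↥(unitaryGroupOfForm σ J)) = flickerPHRho σ m ((Quotient.out w₀ : ↥(flickerPH σ J c)) : ↥(unitaryGroupOfForm σ J))} = q ^ m
  have hSN : flickerPH σ J c ⊓ flickerHK σ J c um ≤ flickerPH0 σ J c (ϖ ^ m) := inf_flickerHK_le_flickerPH0 σ hJ hd hy m hum hc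
  have hNP : flickerPH0 σ J c (ϖ ^ m) ≤ flickerPH σ J c := flickerPH0_le c (ϖ ^ m)
  have hS'N' : ((flickerHK σ J c um).subgroupOf (flickerPH σ J c)) ≤ ((flickerPH0 σ J c (ϖ ^ m)).subgroupOf (flickerPH σ J c)) := by
    intro s hs
    rw [Subgroup.mem_subgroupOf] at hs ⊢
    exact hSN ⟨s.2, hs⟩
  -- (H1) on `P_H`: `ρ p = ρ p' ↔ p⁻¹ p' ∈ N'`
  have hH1 : ∀ p p' : ↥(flickerPH σ J c), flickerPHRho σ m (p : ↥(unitaryGroupOfForm σ J)) = flickerPHRho σ m (p' : ↥(unitaryGroupOfForm σ J)) ↔ p⁻¹ * p' ∈ ((flickerPH0 σ J c (ϖ ^ m)).subgroupOf (flickerPH σ J c)) := by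
    intro p p'
    rw [Subgroup.mem_subgroupOf, Subgroup.coe_mul, Subgroup.coe_inv]
    exact flickerPHRho_eq_iff σ hJ hd hc m p.2 p'.2
  -- the fibre is in bijection with `N' ⧸ S'.subgroupOf N'`
  let F := {w : ↥(flickerPH σ J c) ⧸ ((flickerHK σ J c um).subgroupOf (flickerPH σ J c)) // flickerPHRho σ m ((Quotient.out w : ↥(flickerPH σ J c)) : ↥(unitaryGroupOfForm σ J)) = flickerPHRho σ m ((Quotient.out w₀ : ↥(flickerPH σ J c)) : ↥(unitaryGroupOfForm σ J))}
  have hmemF : ∀ n : ↥((flickerPH0 σ J c (ϖ ^ m)).subgroupOf (flickerPH σ J c)), flickerPHRho σ m ((Quotient.out (QuotientGroup.mk ((Quotient.out w₀ : ↥(flickerPH σ J c)) * (n : ↥(flickerPH σ J c))) : ↥(flickerPH σ J c) ⧸ ((flickerHK σ J c um).subgroupOf (flickerPH σ J c))) : ↥(flickerPH σ J c)) : ↥(unitaryGroupOfForm σ J)) =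
      flickerPHRho σ m ((Quotient.out w₀ : ↥(flickerPH σ J c)) : ↥(unitaryGroupOfForm σ J)) := by
    intro n
    obtain ⟨s, hs⟩ := QuotientGroup.mk_out_eq_mul ((flickerHK σ J c um).subgroupOf (flickerPH σ J c)) ((Quotient.out w₀ : ↥(flickerPH σ J c)) * (n : ↥(flickerPH σ J c)))
    rw [hs, eq_comm, hH1, ← mul_assoc, ← mul_assoc, inv_mul_cancel, one_mul]
    exact Subgroup.mul_mem _ n.2 (hS'N' s.2)
  let ψ : ↥((flickerPH0 σ J c (ϖ ^ m)).subgroupOf (flickerPH σ J c)) → F := fun n => ⟨QuotientGroup.mk ((Quotient.out w₀ : ↥(flickerPH σ J c)) * (n : ↥(flickerPH σ J c))), hmemF n⟩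
  have hψ : ∀ a b : ↥((flickerPH0 σ J c (ϖ ^ m)).subgroupOf (flickerPH σ J c)), QuotientGroup.leftRel (((flickerHK σ J c um).subgroupOf (flickerPH σ J c)).subgroupOf ((flickerPH0 σ J c (ϖ ^ m)).subgroupOf (flickerPH σ J c))) a b → ψ a = ψ b := by
    intro a b hab
    rw [QuotientGroup.leftRel_apply, Subgroup.mem_subgroupOf, Subgroup.coe_mul, Subgroup.coe_inv] at hab
    apply Subtype.ext
    change (QuotientGroup.mk ((Quotient.out w₀ : ↥(flickerPH σ J c)) * (a : ↥(flickerPH σ J c))) : ↥(flickerPH σ J c) ⧸ ((flickerHK σ J c um).subgroupOf (flickerPH σ J c))) = QuotientGroup.mk ((Quotient.out w₀ : ↥(flickerPH σ J c)) * (b : ↥(flickerPH σ J c)))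
    rw [QuotientGroup.eq, _root_.mul_inv_rev, mul_assoc, inv_mul_cancel_left]
    exact hab
  have hbij : Function.Bijective (Quotient.lift ψ hψ : ↥((flickerPH0 σ J c (ϖ ^ m)).subgroupOf (flickerPH σ J c)) ⧸ ((flickerHK σ J c um).subgroupOf (flickerPH σ J c)).subgroupOf ((flickerPH0 σ J c (ϖ ^ m)).subgroupOf (flickerPH σ J c)) → F) := by
    constructor
    · intro q₁ q₂ h
      induction q₁ using QuotientGroup.induction_on with | H a => ?_
      induction q₂ using QuotientGroup.induction_on with | H b => ?_
      apply Quotient.sound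
      change QuotientGroup.leftRel (((flickerHK σ J c um).subgroupOf (flickerPH σ J c)).subgroupOf ((flickerPH0 σ J c (ϖ ^ m)).subgroupOf (flickerPH σ J c))) a b
      rw [QuotientGroup.leftRel_apply, Subgroup.mem_subgroupOf, Subgroup.coe_mul, Subgroup.coe_inv]
      have h' : (QuotientGroup.mk ((Quotient.out w₀ : ↥(flickerPH σ J c)) * (a : ↥(flickerPH σ J c))) : ↥(flickerPH σ J c) ⧸ ((flickerHK σ J c um).subgroupOf (flickerPH σ J c))) = QuotientGroup.mk ((Quotient.out w₀ : ↥(flickerPH σ J c)) * (b : ↥(flickerPH σ J c))) :=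
        congrArg Subtype.val h
      rw [QuotientGroup.eq, _root_.mul_inv_rev, mul_assoc, inv_mul_cancel_left] at h'
      exact h'
    · rintro ⟨w, hw⟩
      have hn : (Quotient.out w₀ : ↥(flickerPH σ J c))⁻¹ * Quotient.out w ∈ ((flickerPH0 σ J c (ϖ ^ m)).subgroupOf (flickerPH σ J c)) := (hH1 _ _).1 hw.symm
      refine ⟨QuotientGroup.mk ⟨_, hn⟩, Subtype.ext ?_⟩
      change (QuotientGroup.mk ((Quotient.out w₀ : ↥(flickerPH σ J c)) * ((Quotient.out w₀ : ↥(flickerPH σ J c))⁻¹ * Quotient.out w)) : ↥(flickerPH σ J c) ⧸ ((flickerHK σ J c um).subgroupOf (flickerPH σ J c))) = w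
      rw [mul_inv_cancel_left, QuotientGroup.out_eq']
  refine (Nat.card_congr (Equiv.ofBijective _ hbij)).symm.trans ?_
  change (((flickerHK σ J c um).subgroupOf (flickerPH σ J c)).subgroupOf ((flickerPH0 σ J c (ϖ ^ m)).subgroupOf (flickerPH σ J c))).index = q ^ m
  rw [← natCard_antifixed_eq σ hd hσO hq ha₀ m, ← index_inf_flickerHK_subgroupOf_flickerPH0 σ hJ hd hy hσO m hum hc]
  -- `[N' : S'] = [N₀ : P_H ∩ H^K_m]`
  change ((flickerHK σ J c um).subgroupOf (flickerPH σ J c)).relIndex ((flickerPH0 σ J c (ϖ ^ m)).subgroupOf (flickerPH σ J c)) = (flickerPH σ J c ⊓ flickerHK σ J c um).relIndex (flickerPH0 σ J c (ϖ ^ m))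
  rw [Subgroup.relIndex_subgroupOf (H := flickerHK σ J c um) hNP,
    ← Subgroup.inf_relIndex_right (flickerHK σ J c um) (flickerPH0 σ J c (ϖ ^ m)),
    ← Subgroup.inf_relIndex_right (flickerPH σ J c ⊓ flickerHK σ J c um) (flickerPH0 σ J c (ϖ ^ m))]
  congr 1
  apply le_antisymm
  · exact le_inf (le_inf (inf_le_right.trans hNP) inf_le_left) inf_le_right
  · exact le_inf (inf_le_left.trans inf_le_right) inf_le_right

end Package

end UnitaryGroup

end Literature.NumberTheory.Automorphic
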